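import Literature.AlgebraicGeometry.Resolution.VertexBlowupProjectionSmooth
import HarnessLib

/-!
# The blow-up of `ℙ^{d+1}` in the vertex: the chart sections lie over the vertex as a `k`-point

Topic: `Literature/AlgebraicGeometry/Resolution`. A complement to
`VertexBlowupProjectionSmooth.lean` (de Jong 1996, proof of Lemma 4.11, p. 68, and 4.12): the
chart sections `s_i : D₊(yᵢ) → P̃` of `q : P̃ → ℙ^d` through the exceptional divisor
(`DeJong1996.vertexChartSection`) lie over the vertex of `ℙ^{d+1}` SCHEME-THEORETICALLY:
`s_i ≫ b` factors through the `k`-rational point `Spec k → ℙ^{d+1}` at the vertex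
(`DeJong1996.vertexPt`). This is what makes the blown-up finite cover
`X' = X ×_{ℙ^{d+1}} P̃ → P̃` of 4.11 split over `s_i(D₊(yᵢ))`, giving local sections of
`f : X' → ℙ^d` and hence "`Y' = ℙ^{d-1}`" in 4.12 without the simple connectedness of `ℙ^{d-1}`
(`NormalizationSection.lean`). PROVED here:

* `DeJong1996.originEval d k : Γ(ℙ^{d+1}, D₊(x_{d+1})) → k` — evaluation at the origin of the
  last chart (`≅ k[X₀, …, X_d]`, constant coefficient), and `DeJong1996.vertexPt d k` — the
  `k`-point `Spec k → D₊(x_{d+1}) ⊆ ℙ^{d+1}` it defines;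
* `sectToAway_comp_toChart` — the section ring map kills the chart coordinates:
  `(k[X][I/Xᵢ] → (k[y]_{(yᵢ)})₀) ∘ (Γ(D₊(x_{d+1})) → k[X][I/Xᵢ]) = (k → (k[y]_{(yᵢ)})₀) ∘ originEval`;
* **`vertexChartSection_comp`** — `s_i ≫ b = (Spec (k[y]_{(yᵢ)})₀ → Spec k) ≫ vertexPt`;
* `vertexPt_apply` — the point of `vertexPt` is the vertex.

No named facts; [folklore] throughout.

## Sources

* A. J. de Jong, *Smoothness, semi-stability and alterations*, Publ. Math. IHÉS 83 (1996),
  proof of Lemma 4.11 and 4.12, p. 68. [DeJong1996]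
* D. Eisenbud, J. Harris, *3264 and All That* (2016), §9.3.2. [EisenbudHarris2016]
-/

noncomputable section

open CategoryTheory CategoryTheory.Limits AlgebraicGeometry TopologicalSpace HomogeneousLocalization

attribute [local instance] MvPolynomial.gradedAlgebra
  Literature.AlgebraicGeometry.Motives.ProjBaseChange.algebraBase
  Literature.AlgebraicGeometry.Motives.ProjBaseChange.isScalarTower_localization

namespace Literature.AlgebraicGeometry.Resolution

universe u

open Literature.AlgebraicGeometry.Motives.Segre (grading chartι toSpec X_mem frac cst)

namespace DeJong1996

variable (d : ℕ) (k : Type u) [Field k]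

/-- **Evaluation at the origin of the last chart**: `Γ(ℙ^{d+1}, D₊(x_{d+1})) ≅ k[X₀, …, X_d] → k`,
`p ↦ p(0)`. [folklore] -/
def originEval : Γ(Proj (grading (Fin (d + 1 + 1)) k),
    (lastChart d k : (Proj (grading (Fin (d + 1 + 1)) k)).Opens)) →+* k :=
  (MvPolynomial.constantCoeff : MvPolynomial (Fin (d + 1)) k →+* k).comp (lastChartEquiv d k).toRingHom

/-- `originEval` kills the coordinate sections `xⱼ/x_{d+1}`. [folklore] -/
@[simp]
theorem originEval_vertexSection (j : Fin (d + 1)) : originEval d k (vertexSection d k j) = 0 := by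
  rw [originEval, RingHom.comp_apply, RingEquiv.toRingHom_eq_coe, RingEquiv.coe_toRingHom,
    lastChartEquiv_vertexSection, MvPolynomial.constantCoeff_X]

/-- **The vertex as a `k`-rational point** `Spec k → D₊(x_{d+1}) ⊆ ℙ^{d+1}`: `Spec` of the
evaluation at the origin followed by the chart. [folklore] -/
def vertexPt : Spec (.of k) ⟶ Proj (grading (Fin (d + 1 + 1)) k) :=
  Spec.map (CommRingCat.ofHom (originEval d k)) ≫ (lastChart d k).2.fromSpec

variable {d k}

/-- `awayBaseEquiv⁻¹ (C c)` is the constant `c`. [folklore] -/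
theorem awayBaseEquiv_symm_C (i : Fin (d + 1)) (c : k) :
    (PointBlowup.awayBaseEquiv d k i).symm (MvPolynomial.C c) =
      algebraMap k (Away (grading (Fin (d + 1)) k) (MvPolynomial.X i)) c := by
  rw [← PointBlowup.cst_eq_algebraMap, ← PointBlowup.awayBaseEquiv_cst d k i c, RingEquiv.symm_apply_apply]

/-- **The section ring map kills the chart coordinates**: through
`Γ(D₊(x_{d+1})) → k[X][I/Xᵢ] → (k[y]_{(yᵢ)})₀` a section `p(X)` goes to the constant `p(0)`.
[folklore] -/
theorem sectToAway_comp_toChart (i : Fin (d + 1)) :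
    (sectToAway d k i).comp (toChart d k i) =
      (algebraMap k (Away (grading (Fin (d + 1)) k) (MvPolynomial.X i))).comp (originEval d k) := by
  refine RingHom.ext fun s => ?_
  rw [RingHom.comp_apply, RingHom.comp_apply, toChart, RingHom.comp_apply, sectToAway, RingHom.comp_apply,
    PointBlowup.sectRingHom_algebraMap, RingEquiv.toRingHom_eq_coe, RingEquiv.coe_toRingHom,
    awayBaseEquiv_symm_C]
  rfl

variable {P : Scheme.{u}} {b : P ⟶ Proj (grading (Fin (d + 1 + 1)) k)}

/-- **`s_i ≫ b` factors through the `k`-point at the vertex**: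
`s_i ≫ b = (Spec (k[y]_{(yᵢ)})₀ → Spec k) ≫ vertexPt`. [cite: DeJong1996, Lemma 4.11 (proof), p. 68] -/
theorem vertexChartSection_comp (hb : IsBlowup b (vertexIdealSheaf d k)) (i : Fin (d + 1)) :
    vertexChartSection hb i ≫ b =
      Spec.map (CommRingCat.ofHom (algebraMap k (Away (grading (Fin (d + 1)) k) (MvPolynomial.X i)))) ≫
        vertexPt d k := by
  rw [vertexChartSection, Category.assoc, vertexChart_comp hb i, ← Spec.map_comp_assoc, ← CommRingCat.ofHom_comp,
    sectToAway_comp_toChart, CommRingCat.ofHom_comp, Spec.map_comp_assoc]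
  rfl

/-- **The point of `vertexPt` is the vertex.** [folklore] -/
theorem vertexPt_apply (hb : IsBlowup b (vertexIdealSheaf d k)) (x : Spec (.of k)) :
    vertexPt d k x = vertex d k := by
  -- any point of `Spec (k[y]_{(y₀)})₀` lies over `x`
  let p : Spec (.of (Away (grading (Fin (d + 1)) k) (MvPolynomial.X (0 : Fin (d + 1))))) :=
    PrimeSpectrum.comap (PointBlowup.awayBaseEquiv d k 0).toRingHom ⟨⊥, Ideal.isPrime_bot⟩
  have hx : Spec.map (CommRingCat.ofHom (algebraMap k (Away (grading (Fin (d + 1)) k)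
      (MvPolynomial.X (0 : Fin (d + 1)))))) p = x := Subsingleton.elim _ _
  rw [← hx, ← Scheme.Hom.comp_apply, ← vertexChartSection_comp hb, Scheme.Hom.comp_apply]
  exact apply_vertexChartSection hb 0 p

end DeJong1996

end Literature.AlgebraicGeometry.Resolution

end
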